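import Literature.NumberTheory.EllipticCurves.CuspFormLFunction
import Literature.NumberTheory.EllipticCurves.HeegnerPoints
import Literature.NumberTheory.Automorphic.Sweep1
import Literature.NumberTheory.LFunctions.KroneckerCharacter
import Literature.FieldTheory.AlgClosed.PadicAlgClEquivComplex
import Mathlib.NumberTheory.LegendreSymbol.JacobiSymbol
import HarnessLib

/-!
# Burungale–Skinner–Tian–Wan (arXiv:2409.01350v2, PREPRINT), §5.4.1 "An auxiliary newform":
# Prop. 5.23 — for an odd prime `p` and an imaginary quadratic field `L` there is a newform
# `g ∈ S₂(Γ₀(N))`, `p ∤ N`, Heegner for `L`, `p`-ordinary, with `ord_{s=1} L(s, g/L) = 1` — and the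
# ORIENTED CM supply its proof yields together with App. B (root number `−1`: `ord_{s=1} L(s, g) = 1`
# AND `L(g ⊗ χ_L, 1) ≠ 0`)

Seat `bsd-stepL-ty-snf` (typer; director-bsd (622)(3), pen bsd-stepL-plan g51 brief
`TY-SNF-BRIEF-g51.md` rev 7, T1). Consumer: the calibrator SUPPLY conjunct `CalibratorSupplyNF L p` of the
newform-shaped calibrator split of crux `ErratumRoadFive.EulerHalfNotRamNoInertSetAtFive`
(stmt-BirchSwinnertonDyer-19715) / aside `KatoValuationIneqNonsplitAtFive` (stmt-…-33169), idea-9 Sketch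
`Cruxes/EulerHalfNotRamNoInertSetAtFive/Lines/bdv_calibration_split_nf_Sketch.lean` rev 1.1 (§4, l.658–682).
Conventions of this directory: UNREFEREED preprint ⇒ explicitly labelled binders (`def … : Prop`,
`[claim: …, status: under-review]` + the printed locator), NEVER a theorem, no `_holds`; nothing is asserted;
no new definition with content except two transparent abbreviations of the tree's own idioms
(`HasAnalyticRankOneAt`, `TwistedLValueOneNeZero` — both copied token for token from the consumer and from
`RohrlichNonvanishing.lean`) and one for the dichotomy printed in Prop. 5.23 (iv); two bookkeeping lemmas PROVED.

## Printed statements (arXiv:2409.01350v2; TeX of record `pub/bsd-eis/lit/src/bstw24-v2/main.tex`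
## sha16 5926f035551c636d, absolute lines «l.N» (body-relative = N − 257 = the litref LABELS column);
## store text `paper:arxiv-2409.01350` = LaTeXML chunks `pNNNN` in EXTRACTION numbering, where this
## proposition is "Prop. 4.23", chunk p0045 L48–91; printed numbers from `LABELS-bstw24-v2.tsv`)

* Standing: §2.1.1 [p0012 L12]: "Throughout `p ≥ 3` will be an odd prime." §2.5.1 (label IQF, l.1805–1812):
  "Throughout, `L ⊂ ℚ̄` will denote an imaginary quadratic field of discriminant `−D_L < 0`. … We will always
  suppose that (ord) `p` splits in `L`: `(p) = v v̄` with `v` determined via `ι_p`". `χ_L : ℤ/D_Lℤ → {±1}` is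
  "the primitive quadratic character of conductor `D_L` associate[d] with `L`" (l.1819). §5 head (l.3705–3706):
  "We continue with the notation and conventions introduced in §§2–4."
* **Prop. 5.23** (label `anrk-prop`, l.4576–4585; PDF p. 54). "There exists a positive integer `N` and a
  newform `g ∈ S₂(Γ₀(N))` such that (i) `p ∤ N`, (ii) every prime `ℓ ∣ N` splits in `L`, (iii) `g` is
  `p`-ordinary, that is, there exists a prime `λ ∣ p` of the Hecke field `F_g` such that `a_p(g)` is a
  `λ`-adic unit, (iv) `ord_{s=1} L(s, g/L) = 1`. Note that condition (ii) is just the usual Heegner condition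
  for the pair `(g, L)`."
* **Proof of Prop. 5.23** (l.4587–4615). "Let `K` be an imaginary quadratic field with discriminant `D_K`
  coprime to `pD_L` and such that `p` splits in `K` and every prime `ℓ ∣ D_K` splits in `L`. Let `λ` be a Hecke
  character over `K` with infinity type `(−1,0)` such that • `λ` is conjugate-dual: `λ^τ = λ^{−1}|·|_K` …,
  • `p ∤ cond(λ)`, and • the conductor of `λ` is only divisible by primes whose residue characteristic is
  split in `L`. In particular, the CM modular form corresponding to the Hecke character `λ` satisfies the
  classical Heegner hypothesis with respect to `L`, and `ε(1/2, λ)·ε(1/2, λχ_L) = −1`. Let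
  `ℓ ∤ 2p·D_K D_L N(cond(λ))` be any prime that splits in both `K` and `L`. Let `𝔛^{ac}_{K,ℓ}` denote the set
  of finite order anticyclotomic Hecke characters over `K` having `ℓ`-power conductor. If `ε(½, λ) = +1`,
  then by the main result of [Ro] (also see [Gr, §1]) `L(1, λχ)·L′(1, λχ_L χ) ≠ 0` for all but finitely many
  `χ ∈ 𝔛^{ac}_{K,ℓ}`. **Otherwise, `L′(1, λχ)·L(1, λχ_L χ) ≠ 0` for all but finitely many `χ ∈ 𝔛^{ac}_{K,ℓ}`.**
  In either case, let `χ₀ ∈ 𝔛^{ac}_{K,ℓ}` be a Hecke character for which the non-vanishing holds. We may then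
  take `g` to be the CM modular form corresponding to the Hecke character `λχ₀`."
* **App. B, proof of Lemma B.2** (label `B-aux-lem`; l.6554–6583), the supply of `λ` with `ε(½, λ) = −1`:
  "Let `𝔔` be the set of primes `q` such that • `q ≡ 3 mod 8`; • `−q` is a square modulo `p`; • `−D_L` is a
  square modulo `q`. … Since `p` is odd and `D_L` has a prime factor not equal to `2` (this is where we use the
  hypothesis that `L ≠ ℚ(√−1), ℚ(√−2)`), … `𝔔` is an infinite set. Let `𝔎` be the set of imaginary quadratic
  fields `K = ℚ(√−q)` for `q ∈ 𝔔`. … the discriminant of `K` is `−D_K = −q`, which means that the class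
  number of `K` is odd. The second condition on `q` is then just the condition that `p` splits in `K`, while
  the third condition is that every prime dividing `D_K` (which is just `q`!) splits in `L`. For `K ∈ 𝔎` let
  `𝔛_K^{can}` be the set of canonical Hecke characters of `K` of infinity type `(−1,0)` [§B.1, l.6441–6443:
  conductor `𝔡_K`, `ψ(τ(x)) = τ(ψ(x))`; (B.2): `ψ|_{𝔸_ℚ^×} = χ_K|·|^{−1}`]. The condition that
  `−D_K = −q ≡ 3 mod 8` means that the root number of each `ψ ∈ 𝔛_K^{can}` is `−1`. If `ℓ` is a prime that
  splits in both `K` and `L` …, then for every anticyclotomic Hecke characters `χ` of `K` of finite `ℓ`-power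
  order and `ℓ`-power conductor the root number of `ψχ` is also `−1`. Moreover, by a theorem of Rohrlich [Ro]
  for all but finitely many such `χ`, `ord_{s=1} L(s, ψχ) = 1` for all `ψ ∈ 𝔛_K^{can}`."
* §7.2 (l.6065): "for a CM form `g ∈ S₂(Γ₀(N))` and `p ∤ 2N`, either `λ ∤ a_p(g)` for all `λ ∣ p` (when `p`
  splits in the CM field) or `a_p(g) = 0`"; App. A (l.6310–6318): "(A-split) `p` splits in `K` and (A-good)
  `(p, 𝔣_ψ) = 1`. This means in particular that `p ∤ N` and `g` is ordinary with respect to `λ`."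
* Rem. 5.24 (label `aux-g-rmk`, l.4617–4619): "It is natural to ask: Does there exist a non-CM elliptic newform
  `g` satisfying Proposition 5.23 (iv)?"

## Transcription (every notion is the tree's; explicit binders, nothing defaulted)

* "`p ≥ 3` odd prime": `[Fact p.Prime]`, `p ≠ 2`. "`L` imaginary quadratic, `p` splits in `L`":
  `IsImaginaryQuadratic L` and `SatisfiesHeegnerHypothesis p L` (`HeegnerPoints.lean`: every prime dividing
  `p`, i.e. `p`, has exactly two primes of `𝓞 L` above it) — EXACTLY the outer binders of the consumer.
  (ord) is a standing hypothesis of §§2–7 and is kept although the statement of Prop. 5.23 does not use it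
  (weaker-or-equal to print). "`L ≠ ℚ(√−1), ℚ(√−2)`" (App. B): `NumberField.discr L ≠ −4 ∧ ≠ −8`.
* "newform `g ∈ S₂(Γ₀(N))`, `N` a positive integer": `[NeZero N]`, `g : CuspForm (Gamma0 N) 2`, `IsNewform0 g`.
  (ii) = `SatisfiesHeegnerHypothesis N L` ("just the usual Heegner condition", l.4585).
* (iii) "there exists a prime `λ ∣ p` of `F_g` such that `a_p(g)` is a `λ`-adic unit": a prime `λ ∣ p` of the
  Hecke field `F_g ⊂ ℂ` is the restriction of the valuation of `ℚ̄_p` along an embedding `F_g ↪ ℚ̄_p`, and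
  every such embedding is `ι′⁻¹|_{F_g}` for a field isomorphism `ι′ : ℚ̄_p ≃ ℂ` (Steinitz; the tree's
  `PadicAlgCl.nonempty_ringEquiv_complex` / `PadicAlgClEquivComplexCompatible`); `a_p(g)` an algebraic
  integer is a `λ`-adic unit iff `‖ι′⁻¹(a_p(g))‖ = 1` in `ℚ̄_p = PadicAlgCl p` (Mathlib's spectral norm).
  So (iii) = `∃ ι′ : PadicAlgCl p ≃+* ℂ, ‖ι′.symm (cuspCoeff g p)‖ = 1` — the consumer's idiom (Sketch §A:
  "`‖·‖_λ := ‖ι′⁻¹(·)‖`"); "for ALL `λ ∣ p`" (§7.2 l.6065, CM case) = `∀ ι′, …`.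
* (iv) "`ord_{s=1} L(s, g/L) = 1`", with `L(s, g/L) = L(s, g)·L(s, g ⊗ χ_L)` (as BSTW use it, §7.2.1 l.6127:
  "`ε(g/L) = ε(g)ε(g′)`", `g′ = g ⊗ χ_L`, §2.5.2): since both orders are natural numbers, "the sum is `1`" is
  the DICHOTOMY `(ord_{s=1} L(s,g) = 1 ∧ L(g ⊗ χ_L, 1) ≠ 0) ∨ (L(g, 1) ≠ 0 ∧ ord_{s=1} L(s, g ⊗ χ_L) = 1)` —
  exactly the two branches "If `ε(½,λ) = +1` … Otherwise …" of the proof. `ord_{s=1} L(s, g) = 1`: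
  `∃ Λ ∈ completedCuspFormLContinuations N g, analyticOrderNatAt Λ 1 = 1` (the consumer's clause; the entire
  continuation of `Λ_N(g,s) = N^{s/2}(2π)^{−s}Γ(s)L(g,s)`, unique, `CuspFormLFunction.lean`; its order at `1`
  is that of `L(g, s)` because `N^{1/2}(2π)^{−1}Γ(1) ≠ 0`); `L(g, 1) ≠ 0`: `Λ 1 ≠ 0` for such `Λ`.
  `L(g ⊗ χ_L, s)`: the tree's `twistedLSeries g χ_L` (`re s > 2`) and an entire `L′` agreeing with it there
  (idiom of `Rohrlich1984_nonvanishing_twists`), `χ_L` a Dirichlet character mod `|d_L|` agreeing with the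
  Jacobi symbol `(d_L/n)` at odd `n` (the consumer's pin; this IS the primitive character of `L`, the tree's
  `kroneckerChar (NumberField.discr L)`, cf. `LFunctions/KroneckerCharacter.lean`, `isKroneckerChar_kroneckerChar`).
* "the CM modular form corresponding to the Hecke character `λχ₀` [of `K`]": `IsCMForm (liftToGamma1 N 2 g)`
  (Ribet's definition, `Automorphic/Sweep1.lean`) together with the CM field made explicit — an imaginary
  quadratic `K` with `p` split in `K` and `a_ℓ(g) = χ_K(ℓ)·a_ℓ(g)` for every prime `ℓ ∤ N` (`a_ℓ = 0` at the
  primes inert in `K`; Ribet 1977 Cor. (3.5), tree fact `Ribet1977_cmNewform_gamma0_of_isGrossencharakter`) —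
  so that a consumer can read off "`p` splits in the CM field" (needed for residual irreducibility of
  `ρ̄_{g,λ} = Ind ψ̄_λ`, which is NOT asserted here and NOT printed in BSTW).

## What is here / what is NOT here (and why)

* `prop523_exists_auxNewform_PRE` — Prop. 5.23 as printed ((iv) as the dichotomy).
* `prop523proof_appB_exists_orientedCMNewform_PRE` — what the PROOF of Prop. 5.23 (second branch,
  l.4608–4614) proves once a character `λ` with `ε(½, λ) = −1` as in its bullet list is supplied, and App. B
  (proof of Lemma B.2, l.6554–6583) supplies one for `L ∉ {ℚ(i), ℚ(√−2)}` (canonical `ψ` of `ℚ(√−q)`,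
  `q ∈ 𝔔`: root number `−1`, `D_K = q` coprime to `pD_L`, `p` split in `K`, `q` split in `L`, conductor
  `𝔡_K = (√−q)` prime to `p`): a CM newform with `ord_{s=1} L(s,g) = 1` AND `L(g ⊗ χ_L, 1) ≠ 0` — the
  orientation the calibrator supply needs. Transcribed from the two printed proofs; labelled as such.
* PROVED: `prop523_dichotomy_of_oriented` (the oriented conclusion is the second branch of (iv)).
* NOT here: Prop. 5.22 (`𝓛_p^{Gr}(g/L) ∉ T_v² 𝓡^{ur}`) and its proof from Prop. 5.23 (BDP formula, Prop.
  (GRL=BDPL)) — no tree carrier for `𝓛_p^{Gr}`, `𝓡^{ur}` (litref TYPER-SHEET-bstw24-v1 §A.3: no two-variable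
  vocabulary); the Galois representation of `g` and the residual irreducibility of `ρ̄_{g_ψ}` (not in BSTW's
  text; App. A l.6280 asserts irreducibility of `V(ψ)_λ`-induced `V(g)_λ` only) — the consumer takes
  `IsGaloisRepOfNewform1` (`NewformGaloisRep.lean`, Deligne/Ribet) and a separate residual fact; Rohrlich's
  theorem itself — ALREADY in the tree as `RohrlichJia_centralOrder_anticyclotomicTwists`
  (`RohrlichAnticyclotomicNonvanishing.lean`; note: BSTW's [Ro] = Invent. Math. 75 (1984) 383–408 is printed
  for `K` of class number one, while App. B applies it to `K = ℚ(√−q)` of odd class number — the general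
  case is Jia, Acta Arith. 2026, Thm. 1, which that tree fact transcribes); the set `𝔛` and Lemma B.2
  (`⋂ F_ψ = ℚ`) — sibling `AuxiliaryHeckeCharactersAppendixBPRE.lean`.

## References

* [BurungaleSkinnerTianWan2024] A. Burungale, C. Skinner, Y. Tian, X. Wan, *Zeta elements for elliptic curves
  and applications*, arXiv:2409.01350v2 (PREPRINT): §2.1.1, §2.5.1 (IQF, (ord)), Prop. 5.23 (anrk-prop,
  l.4576) with proof (l.4587–4615), Rem. 5.24, §7.2 (l.6065), App. A (A-split)/(A-good) (l.6310–6318),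
  App. B proof of Lemma B.2 (l.6554–6583).
* [Rohrlich1984Anticyclotomic] D. E. Rohrlich, Invent. Math. 75 (1984) 383–408 (BSTW's [Ro]); [Jia2026ActaArith].
* [Ribet1977Nebentypus] §3 Cor. (3.5) (CM newform of a Hecke character; `a_p = 0` at inert `p`).
-/

noncomputable section

open scoped MatrixGroups ModularForm

open CongruenceSubgroup NumberField
  Literature.NumberTheory.EllipticCurves.ModularForms Literature.NumberTheory.Automorphic

namespace Literature.NumberTheory.EllipticCurves.BurungaleSkinnerTianWan2024

/-! ### Three transparent abbreviations of tree idioms (definitions with bodies; no content of their own) -/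

/-- **`ord_{s=1} L(s, g) = 1`** for `g ∈ S₂(Γ₀(N))`: the (unique) entire continuation `Λ` of the completed
`L`-function `Λ_N(g, s) = N^{s/2}(2π)^{−s}Γ(s)L(g, s)` (`completedCuspFormLContinuations N g`) has a zero
of order exactly `1` at `s = 1` (`analyticOrderNatAt`; the elementary factor `N^{1/2}(2π)^{−1}Γ(1)` is
non-zero, so this is the order of `L(g, s)`). Token for token the analytic-rank clause of the consumer
`CalibratorSupplyNF`; the clause "`ord_{s=1} L(s, g) = 1`" of Prop. 5.23 (iv) / App. B (viii). A predicate on `g`.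
[cite: BurungaleSkinnerTianWan2024, Prop. 5.23 (iv) (label anrk-prop, TeX l.4582) and App. B (viii) (l.6544)] -/
def HasAnalyticRankOneAt {N : ℕ} (g : CuspForm (Gamma0 N) 2) : Prop :=
  ∃ Λ ∈ completedCuspFormLContinuations N g, analyticOrderNatAt Λ 1 = 1

/-- **`L(g ⊗ χ, 1) ≠ 0`**: some (equivalently every — identity theorem) entire function agreeing with the
twisted `L`-series `L(g ⊗ χ, s) = ∑ χ(n) a_n(g) n^{−s}` (`twistedLSeries g χ`) on `re s > 2` does not vanish
at `s = 1` (idiom of `Rohrlich1984_nonvanishing_twists` and of the consumer `CalibratorSupplyNF`); the clause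
"`L(1, λχ_L·χ) ≠ 0`" of the proof of Prop. 5.23 for `g = g_{λχ}` (and "`ord_{s=1} L(s, g′) = 0`", §7.2.1 l.6102).
A predicate on `(g, χ)`. [cite: BurungaleSkinnerTianWan2024, proof of Prop. 5.23 (label anrk-prop, TeX l.4608–4612)] -/
def TwistedLValueOneNeZero {N : ℕ} (g : CuspForm (Gamma0 N) 2) {m : ℕ} (χ : DirichletCharacter ℂ m) :
    Prop :=
  ∃ L : ℂ → ℂ, Differentiable ℂ L ∧ (∀ s : ℂ, 2 < s.re → L s = twistedLSeries g χ s) ∧ L 1 ≠ 0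

/-- **`ord_{s=1} L(s, g ⊗ χ) = 1`**: an entire continuation of `twistedLSeries g χ` from `re s > 2` has a
zero of order exactly `1` at `s = 1`; the clause "`L′(1, λχ_L·χ) ≠ 0`" (with root number `−1`) of the proof
of Prop. 5.23, first branch, for `g = g_{λχ}`. A predicate on `(g, χ)`.
[cite: BurungaleSkinnerTianWan2024, proof of Prop. 5.23 (label anrk-prop, TeX l.4603–4607)] -/
def HasTwistedAnalyticRankOneAt {N : ℕ} (g : CuspForm (Gamma0 N) 2) {m : ℕ}
    (χ : DirichletCharacter ℂ m) : Prop :=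
  ∃ L : ℂ → ℂ, Differentiable ℂ L ∧ (∀ s : ℂ, 2 < s.re → L s = twistedLSeries g χ s) ∧
    analyticOrderNatAt L 1 = 1

/-- **Prop. 5.23 (iv), "`ord_{s=1} L(s, g/L) = 1`", as the printed proof's dichotomy.** With
`L(s, g/L) = L(s, g)·L(s, g ⊗ χ_L)` (§2.5.2, §7.2.1 "`ε(g/L) = ε(g)ε(g′)`") and both central orders natural
numbers, "the total order is `1`" reads: EITHER `ord_{s=1} L(s, g) = 1` and `L(g ⊗ χ_L, 1) ≠ 0` (the proof's
branch "`ε(½, λ) = −1`: `L′(1, λχ)·L(1, λχ_Lχ) ≠ 0`") OR `L(g, 1) ≠ 0` and `ord_{s=1} L(s, g ⊗ χ_L) = 1` (branch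
"`ε(½, λ) = +1`: `L(1, λχ)·L′(1, λχ_Lχ) ≠ 0`"). `χ_L` = a Dirichlet character mod `|d_L|` agreeing with the
Jacobi symbol `(d_L/n)` at odd `n` (the consumer's pin of the primitive quadratic character of `L`).
[claim: BurungaleSkinnerTianWan2024, status: under-review]
[cite: BurungaleSkinnerTianWan2024, Prop. 5.23 (iv) (label anrk-prop, TeX l.4582) with its proof l.4603–4614] -/
def AnalyticRankOneOverDichotomy {N : ℕ} (g : CuspForm (Gamma0 N) 2) (L : Type) [Field L]
    [NumberField L] : Prop :=
  ∃ χL : DirichletCharacter ℂ (NumberField.discr L).natAbs,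
    (∀ n : ℕ, Odd n → χL n = (jacobiSym (NumberField.discr L) n : ℂ)) ∧
    ((HasAnalyticRankOneAt g ∧ TwistedLValueOneNeZero g χL) ∨
      ((∃ Λ ∈ completedCuspFormLContinuations N g, Λ 1 ≠ 0) ∧ HasTwistedAnalyticRankOneAt g χL))

/-! ### Prop. 5.23 as printed -/

/-- **OPEN BINDER — UNREFEREED PREPRINT (arXiv:2409.01350v2), Prop. 5.23 (label `anrk-prop`; extraction
"Prop. 4.23", chunk p0045 L48–59).** For an odd prime `p` and an imaginary quadratic field `L` in which `p`
splits (standing (ord), §2.5.1): "There exists a positive integer `N` and a newform `g ∈ S₂(Γ₀(N))` such that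
(i) `p ∤ N`, (ii) every prime `ℓ ∣ N` splits in `L`, (iii) `g` is `p`-ordinary, that is, there exists a prime
`λ ∣ p` of the Hecke field `F_g` such that `a_p(g)` is a `λ`-adic unit, (iv) `ord_{s=1} L(s, g/L) = 1`."
Transcription (module docstring): (ii) = `SatisfiesHeegnerHypothesis N L` ("just the usual Heegner
condition", l.4585); (iii) = `∃ ι′ : ℚ̄_p ≃ ℂ, ‖ι′⁻¹(a_p(g))‖ = 1`; (iv) = `AnalyticRankOneOverDichotomy g L`.
Nothing asserted; NEVER cite this `Prop` as a theorem. Proof in print: CM form of `λχ₀` over an auxiliary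
`K`, Rohrlich's anticyclotomic non-vanishing (tree: `RohrlichJia_centralOrder_anticyclotomicTwists`).
[claim: BurungaleSkinnerTianWan2024, status: under-review]
[cite: BurungaleSkinnerTianWan2024, Prop. 5.23 (label anrk-prop, TeX l.4576–4585; PDF p. 54) with §2.1.1 (p odd) and §2.5.1 (ord) (label IQF, l.1810)] -/
def prop523_exists_auxNewform_PRE : Prop :=
  ∀ (p : ℕ) [Fact p.Prime], p ≠ 2 → ∀ (L : Type) [Field L] [NumberField L],
    IsImaginaryQuadratic L → SatisfiesHeegnerHypothesis p L →
    ∃ (N : ℕ) (_ : NeZero N) (g : CuspForm (Gamma0 N) 2),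
      IsNewform0 g ∧ ¬ p ∣ N ∧ SatisfiesHeegnerHypothesis N L ∧
      (∃ ι' : PadicAlgCl p ≃+* ℂ, ‖ι'.symm (cuspCoeff g p)‖ = 1) ∧
      AnalyticRankOneOverDichotomy g L

/-! ### The oriented CM supply (proof of Prop. 5.23, second branch, with App. B's characters) -/

/-- **OPEN BINDER — UNREFEREED PREPRINT (arXiv:2409.01350v2): the ORIENTED auxiliary CM newform of the
PROOF of Prop. 5.23 (second branch, TeX l.4608–4614) fed with App. B's characters of root number `−1`
(proof of Lemma B.2, l.6554–6583).** For an odd prime `p` and an imaginary quadratic field `L ≠ ℚ(√−1),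
ℚ(√−2)` in which `p` splits: there are `N ≥ 1` and a newform `g ∈ S₂(Γ₀(N))` which is a CM form — by an
imaginary quadratic field `K` in which `p` splits (`a_ℓ(g) = χ_K(ℓ)a_ℓ(g)` for all primes `ℓ ∤ N`) — with
(i) `p ∤ N`, (ii) every prime `ℓ ∣ N` split in `L`, (iii)⁺ `a_p(g)` a `λ`-adic unit for EVERY `λ ∣ p` (§7.2
l.6065: "for a CM form `g ∈ S₂(Γ₀(N))` and `p ∤ 2N`, … `λ ∤ a_p(g)` for all `λ ∣ p` (when `p` splits in the CM
field)"; App. A l.6318), and (iv)⁻ `ord_{s=1} L(s, g) = 1` together with `L(g ⊗ χ_L, 1) ≠ 0`. How print gives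
it: take `q ∈ 𝔔` (`q ≡ 3 mod 8`, `−q` a square mod `p`, `−D_L` a square mod `q`; `𝔔 ≠ ∅` uses `p` odd and
`L ∉ {ℚ(i), ℚ(√−2)}`, l.6564–6566), `K = ℚ(√−q)` (so `D_K = q` is coprime to `pD_L`, `p` splits in `K`, `q`
splits in `L`), `λ = ψ ∈ 𝔛_K^{can}` (infinity type `(−1,0)`, conjugate-dual, conductor `𝔡_K = (√−q)` prime to
`p` and supported on a prime split in `L`, root number `ε(½, ψ) = −1`, l.6574–6576), a prime `ℓ ∤ 2pqD_L`
split in `K` and `L`; then "Otherwise [`ε(½,λ) = −1`], `L′(1, λχ)·L(1, λχ_Lχ) ≠ 0` for all but finitely many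
`χ ∈ 𝔛^{ac}_{K,ℓ}`" (Rohrlich) and "`g` the CM modular form corresponding to `λχ₀`" has `L(s, g) = L(s, λχ₀)`
of order exactly `1` at `s = 1` (root number `−1`, l.6577–6579, and `L′ ≠ 0`) and
`L(g ⊗ χ_L, 1) = L(1, λχ₀χ_L) ≠ 0`, while (i)–(iii) are as in the proof of Prop. 5.23 (`p ∤ cond(λχ₀) = 𝔡_Kℓⁿ`,
Heegner from `q, ℓ` split in `L`, ordinarity from `p` split in `K`). This is the orientation the consumer
`CalibratorSupplyNF L p` needs (its conjuncts `IsNewform0`, `p ∤ 2N` [from `p` odd], ordinarity, Heegner,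
analytic rank one, twisted non-vanishing); the two conjuncts it does NOT supply — a `ℚ̄_p`-representation
attached to `g` (tree: `IsGaloisRepOfNewform1`, Deligne/Ribet) and the absolute irreducibility of
`ρ̄_{g,λ} = Ind ψ̄_λ` — are not in BSTW's text and are NOT asserted here. Transcription as in
`prop523_exists_auxNewform_PRE`; "CM by `K`" made explicit for downstream use. Nothing asserted; NEVER cite
this `Prop` as a theorem; it is STRONGER than the statement of Prop. 5.23 and EQUAL to what its printed
proof establishes in the case `ε(½, λ) = −1`.
[claim: BurungaleSkinnerTianWan2024, status: under-review]
[cite: BurungaleSkinnerTianWan2024, proof of Prop. 5.23 (label anrk-prop, TeX l.4587–4615, second branch l.4608–4614) with App. B, proof of Lemma B.2 (label B-aux-lem, l.6554–6583: the set 𝔔, K = ℚ(√−q), canonical ψ of root number −1) and §7.2 l.6065 (λ ∤ a_p for all λ ∣ p)]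
[cite: Rohrlich1984Anticyclotomic, Theorem (p. 384)] -/
def prop523proof_appB_exists_orientedCMNewform_PRE : Prop :=
  ∀ (p : ℕ) [Fact p.Prime], p ≠ 2 → ∀ (L : Type) [Field L] [NumberField L],
    IsImaginaryQuadratic L → SatisfiesHeegnerHypothesis p L →
    NumberField.discr L ≠ -4 → NumberField.discr L ≠ -8 →
    ∃ (N : ℕ) (_ : NeZero N) (g : CuspForm (Gamma0 N) 2),
      IsNewform0 g ∧ ¬ p ∣ N ∧ SatisfiesHeegnerHypothesis N L ∧
      -- `g` is a CM form, by an imaginary quadratic `K` in which `p` splits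
      IsCMForm (liftToGamma1 N 2 g) ∧
      (∃ (K : Type) (_ : Field K) (_ : NumberField K), IsImaginaryQuadratic K ∧
        SatisfiesHeegnerHypothesis p K ∧
        ∃ χK : DirichletCharacter ℂ (NumberField.discr K).natAbs,
          (∀ n : ℕ, Odd n → χK n = (jacobiSym (NumberField.discr K) n : ℂ)) ∧
          ∀ ℓ : ℕ, ℓ.Prime → ¬ ℓ ∣ N → χK ℓ * cuspCoeff g ℓ = cuspCoeff g ℓ) ∧
      -- (iii)⁺ `λ`-ordinary for every `λ ∣ p`
      (∀ ι' : PadicAlgCl p ≃+* ℂ, ‖ι'.symm (cuspCoeff g p)‖ = 1) ∧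
      -- (iv)⁻ analytic rank of `g` exactly one, and `L(g ⊗ χ_L, 1) ≠ 0`
      HasAnalyticRankOneAt g ∧
      ∃ χL : DirichletCharacter ℂ (NumberField.discr L).natAbs,
        (∀ n : ℕ, Odd n → χL n = (jacobiSym (NumberField.discr L) n : ℂ)) ∧
        TwistedLValueOneNeZero g χL

/-! ### Bookkeeping (proved) -/

/-- **The oriented conclusion is the second branch of Prop. 5.23 (iv)**: analytic rank one of `g` and
`L(g ⊗ χ_L, 1) ≠ 0` give the dichotomy `AnalyticRankOneOverDichotomy g L`.
[cite: BurungaleSkinnerTianWan2024, proof of Prop. 5.23 (label anrk-prop, TeX l.4608–4614)] -/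
theorem analyticRankOneOverDichotomy_of_oriented {N : ℕ} (g : CuspForm (Gamma0 N) 2) (L : Type)
    [Field L] [NumberField L] (h1 : HasAnalyticRankOneAt g)
    (h2 : ∃ χL : DirichletCharacter ℂ (NumberField.discr L).natAbs,
      (∀ n : ℕ, Odd n → χL n = (jacobiSym (NumberField.discr L) n : ℂ)) ∧ TwistedLValueOneNeZero g χL) :
    AnalyticRankOneOverDichotomy g L := by
  obtain ⟨χL, hχ, hne⟩ := h2
  exact ⟨χL, hχ, Or.inl ⟨h1, hne⟩⟩

/-- **The oriented supply implies Prop. 5.23** (on `L ∉ {ℚ(i), ℚ(√−2)}`): granted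
`prop523proof_appB_exists_orientedCMNewform_PRE`, the newform it provides satisfies (i)–(iv) of Prop. 5.23,
(iii) for the place of any `ι′ : ℚ̄_p ≃ ℂ` (one exists: `PadicAlgCl.nonempty_ringEquiv_complex`).
[cite: BurungaleSkinnerTianWan2024, Prop. 5.23 (label anrk-prop, TeX l.4576–4615)] -/
theorem prop523_of_oriented (h : prop523proof_appB_exists_orientedCMNewform_PRE) (p : ℕ) [Fact p.Prime]
    (hp : p ≠ 2) (L : Type) [Field L] [NumberField L] (hL : IsImaginaryQuadratic L)
    (hsp : SatisfiesHeegnerHypothesis p L) (h4 : NumberField.discr L ≠ -4) (h8 : NumberField.discr L ≠ -8) :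
    ∃ (N : ℕ) (_ : NeZero N) (g : CuspForm (Gamma0 N) 2),
      IsNewform0 g ∧ ¬ p ∣ N ∧ SatisfiesHeegnerHypothesis N L ∧
      (∃ ι' : PadicAlgCl p ≃+* ℂ, ‖ι'.symm (cuspCoeff g p)‖ = 1) ∧
      AnalyticRankOneOverDichotomy g L := by
  obtain ⟨N, hN, g, hnew, hpN, hH, -, -, hord, hrk, hχ⟩ := h p hp L hL hsp h4 h8
  obtain ⟨ι'⟩ := PadicAlgCl.nonempty_ringEquiv_complex p
  exact ⟨N, hN, g, hnew, hpN, hH, ⟨ι', hord ι'⟩, analyticRankOneOverDichotomy_of_oriented g L hrk hχ⟩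

end Literature.NumberTheory.EllipticCurves.BurungaleSkinnerTianWan2024

end
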